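import Summits.QuantumFields.YangMills.Theorems.AllWindowsColdBoxBoxKernelGradientDecay

/-!
# D/N box Green functions: symmetry on all integer points and decay of SHIFTED differences (wall variants)

Supplement to the box-kernel package (`…BoxKernelGreen/HessianDecay/GradientDecay/SizeDecay`) needed by the instantiation of the
Schur–Jaffard theorem for the Landau/Hodge kernel (STUB-PLAN-U1 §7, stub S3b `LandauKernelDecay`):

* `torusGreen_eq_of_forall_eq_or_eq_neg`, **`boxGreen_comm`** — `G_B(y, y') = G_B(y', y)` for ALL integer points (not only box points),
  so that Dirichlet vanishing and the first-slot estimates transfer to the second slot;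
* `torusGreen_hessian_image_le` — the per-image Hessian bound (the internal step of `boxGreen_hessian_decay`, now a lemma);
* **`boxGreen_grad_fst_decay_shift`**, **`boxGreen_hessian_decay_shift`** — the gradient / mixed-Hessian decay with the base points
  shifted DOWN by one lattice step (`y ∈ {s, s − e_a}`, `y' ∈ {s', s' − e_b}` for box points `s, s'`): these cover the differences with the
  Dirichlet ghost row (`G_B(s − e_a, ·) = 0` at `s_a = 1`), i.e. the wall-adjacent entries, with the SAME weights `(1 + |s_κ − s'_κ|)^{3,4}`.

Everything proved; standard axioms.  HONEST LABEL: kernel bookkeeping; no stub, crux, rung or summit is proved; the Yang–Mills mass gap is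
NOT proved by this file.
-/

set_option autoImplicit false

noncomputable section

open Finset ZMod
open scoped Real BigOperators

namespace Summit.QuantumFields.YangMills.Theorems.AllWindowsColdBox.BoxKernel

open Literature.Probability.LatticeModels

variable {d : ℕ}

/-! ## Symmetry on all integer points -/

/-- The torus Green function only sees the coordinates up to sign. -/
theorem torusGreen_eq_of_forall_eq_or_eq_neg {L : ℕ} [NeZero L] (a b : TorusSite d L) (h : ∀ κ, b κ = a κ ∨ b κ = -a κ) :
    torusGreen b = torusGreen a := by
  classical
  suffices hS : ∀ (S : Finset (Fin d)) (b : TorusSite d L), (∀ κ, κ ∉ S → b κ = a κ) → (∀ κ, b κ = a κ ∨ b κ = -a κ) →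
      torusGreen b = torusGreen a from hS Finset.univ b (fun κ hκ => absurd (Finset.mem_univ κ) hκ) h
  intro S
  induction S using Finset.induction_on with
  | empty =>
      intro b hb _
      have : b = a := funext fun κ => hb κ (by simp)
      rw [this]
  | @insert ν S hνS ih =>
      intro b hb hor
      set b' : TorusSite d L := Function.update b ν (a ν) with hb'
      have hb'S : ∀ κ, κ ∉ S → b' κ = a κ := by
        intro κ hκ
        by_cases hκν : κ = ν
        · subst hκν; simp [hb']
        · rw [hb', Function.update_of_ne hκν]
          exact hb κ (by simp [hκν, hκ])
      have hor' : ∀ κ, b' κ = a κ ∨ b' κ = -a κ := by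
        intro κ
        by_cases hκν : κ = ν
        · subst hκν; simp [hb']
        · rw [hb', Function.update_of_ne hκν]; exact hor κ
      have h1 : torusGreen b' = torusGreen a := ih b' hb'S hor'
      rcases hor ν with hν | hν
      · have : b = b' := by
          funext κ
          by_cases hκν : κ = ν
          · subst hκν; simp [hb', hν]
          · rw [hb', Function.update_of_ne hκν]
        rw [this, h1]
      · have : b = Function.update b' ν (-b' ν) := by
          funext κ
          by_cases hκν : κ = ν
          · subst hκν; simp [hb', hν]
          · rw [Function.update_of_ne hκν, hb', Function.update_of_ne hκν]
        rw [this, torusGreen_reflect, h1]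

variable {M : ℕ} [NeZero M] {Dset : Finset (Fin d)}

/-- **The box Green function is symmetric on all integer points.** -/
theorem boxGreen_comm (y y' : Fin d → ℤ) : boxGreen M Dset y y' = boxGreen M Dset y' y := by
  unfold boxGreen imageSum
  congr 1
  refine Finset.sum_congr rfl fun σ _ => ?_
  congr 1
  apply torusGreen_eq_of_forall_eq_or_eq_neg
  intro κ
  rw [sub_refl_apply, sub_refl_apply]
  by_cases hσ : σ κ = true
  · left
    by_cases hκ : κ ∈ Dset
    · simp only [hσ, hκ, if_true]; push_cast; ring
    · simp only [hσ, hκ, if_true, if_false]; push_cast; ring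
  · right
    simp only [hσ, Bool.false_eq_true, if_false]; push_cast; ring

/-- Dirichlet vanishing in the SECOND slot below the bottom face. -/
theorem boxGreen_dirichlet_bottom_snd {ν : Fin d} (hν : ν ∈ Dset) (s : Box d M Dset) (h : (s.1 ν : ℕ) = 1) (y : Fin d → ℤ) :
    boxGreen M Dset y (coords s - Pi.single ν 1) = 0 := by
  rw [boxGreen_comm]; exact boxGreen_dirichlet_bottom hν s h y

/-- Dirichlet vanishing in the SECOND slot above the top face. -/
theorem boxGreen_dirichlet_top_snd {ν : Fin d} (hν : ν ∈ Dset) (s : Box d M Dset) (h : (s.1 ν : ℕ) + 1 = M) (y : Fin d → ℤ) :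
    boxGreen M Dset y (coords s + Pi.single ν 1) = 0 := by
  rw [boxGreen_comm]; exact boxGreen_dirichlet_top hν s h y

/-! ## Shifted base points: the coordinates of the image points -/

omit [NeZero M] in
/-- The `κ`-coordinate of `ι y − σ·ι y'` for base points shifted down by `t e_a`, `t' e_b` (`t, t' ∈ {0, −1}`) from `s, s'`:
the class of `s_κ − r + δ₀` with `r` an image of `s'_κ` and `δ₀ = t[κ=a] ± t'[κ=b]`. -/
theorem sub_refl_apply_shift (σ : Fin d → Bool) (s s' : Box d M Dset) (a b : Fin d) (t t' : ℤ) (κ : Fin d) :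
    (toTorus M (coords s + Pi.single a t : Fin d → ℤ) - refl M Dset σ (toTorus M (coords s' + Pi.single b t' : Fin d → ℤ))) κ =
      (((coords s κ - (if σ κ then (if κ ∈ Dset then -coords s' κ else -1 - coords s' κ) else coords s' κ) +
          ((if κ = a then t else 0) + (if σ κ then (if κ = b then t' else 0) else -(if κ = b then t' else 0))) : ℤ)) :
        ZMod (2 * M)) := by
  rw [sub_refl_apply]
  simp only [Pi.add_apply, Pi.single_apply]
  by_cases hσ : σ κ = true
  · by_cases hD : κ ∈ Dset
    · simp only [hσ, hD, if_true]; push_cast; ring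
    · simp only [hσ, hD, if_true, if_false]; push_cast; ring
  · simp only [hσ, Bool.false_eq_true, if_false]; push_cast; ring

/-! ## Shifted gradient decay (first slot) -/

/-- **Gradient decay with a shifted base point**: for box points `s, s'`, `t ∈ {0, −1}` and `y = s + t e_a`,
`|G_B(y + e_a, s') − G_B(y, s')|·(1 + |s_κ − s'_κ|)³ ≤ C` (the case `t = −1`, `s_a = 1` is the wall-adjacent entry `G_B(s, s')` itself). -/
theorem boxGreen_grad_fst_decay_shift : ∃ C : ℝ, 0 ≤ C ∧ ∀ (M : ℕ) [NeZero M] (Dset : Finset (Fin 4)) (a κ : Fin 4) (t : ℤ),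
    (t = 0 ∨ t = -1) → ∀ (s s' : Box 4 M Dset),
    |boxGreen M Dset (coords s + Pi.single a t + Pi.single a 1) (coords s') - boxGreen M Dset (coords s + Pi.single a t) (coords s')| *
      (1 + |(((s.1 κ : ℕ) : ℝ)) - ((s'.1 κ : ℕ) : ℝ)|) ^ 3 ≤ C := by
  obtain ⟨C₁, hC₁0, hG⟩ := torusGreen_grad_le
  refine ⟨216 * C₁, by positivity, ?_⟩
  intro M _ Dset a κ t ht s s'
  set n : ℝ := |(((s.1 κ : ℕ) : ℝ)) - ((s'.1 κ : ℕ) : ℝ)| with hn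
  rw [boxGreen_grad_fst_eq]
  have h0 : coords s' = coords s' + Pi.single a (0 : ℤ) := by simp
  set T : (Fin 4 → Bool) → ℝ := fun σ =>
    torusGreen (toTorus M (coords s + Pi.single a t) - refl M Dset σ (toTorus M (coords s')) + Pi.single a 1) -
      torusGreen (toTorus M (coords s + Pi.single a t) - refl M Dset σ (toTorus M (coords s'))) with hT
  have hTσ : ∀ σ : Fin 4 → Bool, |T σ| * (1 + n) ^ 3 ≤ 27 * C₁ := by
    intro σ
    refine torusGreen_grad_image_le hG s s' κ a σ _ (if κ = a then t else 0) (by split_ifs <;> omega) (by split_ifs <;> omega) ?_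
    conv_lhs => rw [h0]
    rw [sub_refl_apply_shift]
    congr 1
    split_ifs <;> ring
  have h12 : (0 : ℝ) < 1 / 2 := by norm_num
  calc |(1 / 2 : ℝ) * ∑ σ : Fin 4 → Bool, sgn Dset σ * T σ| * (1 + n) ^ 3
        = (1 / 2 : ℝ) * (|∑ σ : Fin 4 → Bool, sgn Dset σ * T σ| * (1 + n) ^ 3) := by rw [abs_mul, abs_of_pos h12, mul_assoc]
    _ ≤ (1 / 2 : ℝ) * ((∑ σ : Fin 4 → Bool, |sgn Dset σ * T σ|) * (1 + n) ^ 3) :=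
        mul_le_mul_of_nonneg_left (mul_le_mul_of_nonneg_right (Finset.abs_sum_le_sum_abs _ _) (by positivity)) h12.le
    _ = (1 / 2 : ℝ) * ∑ σ : Fin 4 → Bool, |T σ| * (1 + n) ^ 3 := by
        rw [Finset.sum_mul]; congr 1
        exact Finset.sum_congr rfl fun σ _ => by rw [abs_mul, abs_sgn, one_mul]
    _ ≤ (1 / 2 : ℝ) * ∑ σ : Fin 4 → Bool, (27 * C₁ : ℝ) := mul_le_mul_of_nonneg_left (Finset.sum_le_sum fun σ _ => hTσ σ) h12.le
    _ = 216 * C₁ := by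
        rw [Finset.sum_const, Finset.card_univ, Fintype.card_fun, Fintype.card_bool, Fintype.card_fin, nsmul_eq_mul]
        push_cast; ring

/-! ## Shifted mixed-Hessian decay -/

/-- Per-image Hessian bound: if the `κ`-coordinate of `z` is the class of `s_κ − r + δ` (`r` an image of `s'_κ`, `|δ| ≤ 1`), then
`|H_{ab}(z)|·(1 + |s_κ − s'_κ|)⁴ ≤ 81 C₁` with `H_{ab}(z) = G̃(z+e_a) − G̃(z+e_a−e_b) − G̃(z) + G̃(z−e_b)` and `C₁` the constant of
`torusGreen_hessian_le`. -/
theorem torusGreen_hessian_image_le {C₁ : ℝ}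
    (hH : ∀ (L : ℕ) [NeZero L], 2 ≤ L → ∀ (a b : Fin 4) (z : TorusSite 4 L),
      |torusGreen (z + Pi.single a 1) - torusGreen (z + Pi.single a 1 - Pi.single b 1) - torusGreen z + torusGreen (z - Pi.single b 1)| *
        (max 1 (Real.sqrt (∑ k, (((z k).valMinAbs : ℤ) : ℝ) ^ 2))) ^ 4 ≤ C₁)
    {M : ℕ} [NeZero M] {Dset : Finset (Fin 4)} (s s' : Box 4 M Dset) (κ a b : Fin 4) (σ : Fin 4 → Bool) (z : TorusSite 4 (2 * M))
    (δ : ℤ) (hδ0 : -1 ≤ δ) (hδ1 : δ ≤ 1)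
    (hz : z κ = (((coords s κ - (if σ κ then (if κ ∈ Dset then -coords s' κ else -1 - coords s' κ) else coords s' κ) + δ : ℤ)) :
      ZMod (2 * M))) :
    |torusGreen (z + Pi.single a 1) - torusGreen (z + Pi.single a 1 - Pi.single b 1) - torusGreen z + torusGreen (z - Pi.single b 1)| *
      (1 + |(((s.1 κ : ℕ) : ℝ)) - ((s'.1 κ : ℕ) : ℝ)|) ^ 4 ≤ 81 * C₁ := by
  have hL : 2 ≤ 2 * M := by have := Nat.pos_of_ne_zero (NeZero.ne M); omega
  set n : ℝ := |(((s.1 κ : ℕ) : ℝ)) - ((s'.1 κ : ℕ) : ℝ)| with hn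
  have hn0 : 0 ≤ n := abs_nonneg _
  have hnint : n = (( |coords s κ - coords s' κ| : ℤ) : ℝ) := by rw [hn]; simp [coords]
  have hs0 : 0 ≤ coords s κ := by simp [coords]
  have hsM : coords s κ < M := by simp only [coords]; exact_mod_cast (s.1 κ).isLt
  have hs0' : 0 ≤ coords s' κ := by simp [coords]
  have hsM' : coords s' κ < M := by simp only [coords]; exact_mod_cast (s'.1 κ).isLt
  have hHz := hH (2 * M) hL a b z
  have hfar : (( |coords s κ - coords s' κ| : ℤ) : ℝ) - 1 ≤ Real.sqrt (∑ k, (((z k).valMinAbs : ℤ) : ℝ) ^ 2) := by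
    refine le_trans ?_ (abs_valMinAbs_le_dist z κ)
    rw [hz, ← Int.cast_one, ← Int.cast_sub, ← Int.cast_abs, Int.cast_le]
    refine le_abs_valMinAbs_of_forall (2 * M) _ _ fun j => ?_
    have hm : (coords s κ - (if σ κ then (if κ ∈ Dset then -coords s' κ else -1 - coords s' κ) else coords s' κ)) =
          coords s κ - coords s' κ ∨
        (coords s κ - (if σ κ then (if κ ∈ Dset then -coords s' κ else -1 - coords s' κ) else coords s' κ)) =
          coords s κ + coords s' κ ∨
        (coords s κ - (if σ κ then (if κ ∈ Dset then -coords s' κ else -1 - coords s' κ) else coords s' κ)) =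
          coords s κ + coords s' κ + 1 := by
      split_ifs
      · right; left; ring
      · right; right; ring
      · left; rfl
    exact repr_bound hs0 hsM hs0' hsM' hδ0 hδ1 hm j
  rw [← hnint] at hfar
  have hmax : 1 + n ≤ 3 * max 1 (Real.sqrt (∑ k, (((z k).valMinAbs : ℤ) : ℝ) ^ 2)) := by
    rcases le_or_gt 2 n with h2 | h2
    · calc 1 + n ≤ 3 * (n - 1) := by linarith
        _ ≤ 3 * max 1 (Real.sqrt (∑ k, (((z k).valMinAbs : ℤ) : ℝ) ^ 2)) :=
            mul_le_mul_of_nonneg_left (hfar.trans (le_max_right _ _)) (by norm_num)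
    · calc 1 + n ≤ 3 * 1 := by linarith
        _ ≤ 3 * max 1 (Real.sqrt (∑ k, (((z k).valMinAbs : ℤ) : ℝ) ^ 2)) :=
            mul_le_mul_of_nonneg_left (le_max_left _ _) (by norm_num)
  have hpow : (1 + n) ^ 4 ≤ 81 * (max 1 (Real.sqrt (∑ k, (((z k).valMinAbs : ℤ) : ℝ) ^ 2))) ^ 4 := by
    calc (1 + n) ^ 4 ≤ (3 * max 1 (Real.sqrt (∑ k, (((z k).valMinAbs : ℤ) : ℝ) ^ 2))) ^ 4 :=
          pow_le_pow_left₀ (by linarith) hmax 4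
      _ = 81 * (max 1 (Real.sqrt (∑ k, (((z k).valMinAbs : ℤ) : ℝ) ^ 2))) ^ 4 := by ring
  calc |torusGreen (z + Pi.single a 1) - torusGreen (z + Pi.single a 1 - Pi.single b 1) - torusGreen z +
          torusGreen (z - Pi.single b 1)| * (1 + n) ^ 4
        ≤ |torusGreen (z + Pi.single a 1) - torusGreen (z + Pi.single a 1 - Pi.single b 1) - torusGreen z +
          torusGreen (z - Pi.single b 1)| * (81 * (max 1 (Real.sqrt (∑ k, (((z k).valMinAbs : ℤ) : ℝ) ^ 2))) ^ 4) :=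
        mul_le_mul_of_nonneg_left hpow (abs_nonneg _)
    _ = 81 * (|torusGreen (z + Pi.single a 1) - torusGreen (z + Pi.single a 1 - Pi.single b 1) - torusGreen z +
          torusGreen (z - Pi.single b 1)| * (max 1 (Real.sqrt (∑ k, (((z k).valMinAbs : ℤ) : ℝ) ^ 2))) ^ 4) := by ring
    _ ≤ 81 * C₁ := mul_le_mul_of_nonneg_left hHz (by norm_num)

/-- Bookkeeping: the total coordinate shift of an image point is at most one lattice step (case `σ_b` flipped). -/
theorem shift_bound_pos {t t' : ℤ} (ht : t = 0 ∨ t = -1) (ht' : t' = 0 ∨ t' = -1) (A B S : Prop) [Decidable A] [Decidable B]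
    [Decidable S] (hBS : B → S) :
    -1 ≤ (if A then t else 0) + (if S then (if B then t' else 0) else -(if B then t' else 0)) + (if B then 1 else 0) ∧
      (if A then t else 0) + (if S then (if B then t' else 0) else -(if B then t' else 0)) + (if B then 1 else 0) ≤ 1 := by
  by_cases hA : A <;> by_cases hB : B <;> by_cases hS : S <;> simp only [hA, hB, hS, if_true, if_false] <;>
    first | omega | exact (hS (hBS hB)).elim

/-- Bookkeeping: the total coordinate shift of an image point is at most one lattice step (case `σ_b` not flipped). -/
theorem shift_bound_neg {t t' : ℤ} (ht : t = 0 ∨ t = -1) (ht' : t' = 0 ∨ t' = -1) (A B S : Prop) [Decidable A] [Decidable B]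
    [Decidable S] (hBS : B → ¬ S) :
    -1 ≤ (if A then t else 0) + (if S then (if B then t' else 0) else -(if B then t' else 0)) ∧
      (if A then t else 0) + (if S then (if B then t' else 0) else -(if B then t' else 0)) ≤ 1 := by
  by_cases hA : A <;> by_cases hB : B <;> by_cases hS : S <;> simp only [hA, hB, hS, if_true, if_false] <;>
    first | omega | exact (hBS hB hS).elim

/-- **Mixed-Hessian decay with shifted base points**: for box points `s, s'`, `t, t' ∈ {0, −1}`, `y = s + t e_a`, `y' = s' + t' e_b`,
`|G_B(y+e_a, y'+e_b) − G_B(y+e_a, y') − G_B(y, y'+e_b) + G_B(y, y')|·(1 + |s_κ − s'_κ|)⁴ ≤ C`. -/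
theorem boxGreen_hessian_decay_shift : ∃ C : ℝ, 0 ≤ C ∧ ∀ (M : ℕ) [NeZero M] (Dset : Finset (Fin 4)) (a b κ : Fin 4) (t t' : ℤ),
    (t = 0 ∨ t = -1) → (t' = 0 ∨ t' = -1) → ∀ (s s' : Box 4 M Dset),
    |boxGreen M Dset (coords s + Pi.single a t + Pi.single a 1) (coords s' + Pi.single b t' + Pi.single b 1) -
        boxGreen M Dset (coords s + Pi.single a t + Pi.single a 1) (coords s' + Pi.single b t') -
        boxGreen M Dset (coords s + Pi.single a t) (coords s' + Pi.single b t' + Pi.single b 1) +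
        boxGreen M Dset (coords s + Pi.single a t) (coords s' + Pi.single b t')| *
      (1 + |(((s.1 κ : ℕ) : ℝ)) - ((s'.1 κ : ℕ) : ℝ)|) ^ 4 ≤ C := by
  obtain ⟨C₁, hC₁0, hH⟩ := torusGreen_hessian_le
  refine ⟨648 * C₁, by positivity, ?_⟩
  intro M _ Dset a b κ t t' ht ht' s s'
  set y : Fin 4 → ℤ := coords s + Pi.single a t with hy
  set y' : Fin 4 → ℤ := coords s' + Pi.single b t' with hy'
  set n : ℝ := |(((s.1 κ : ℕ) : ℝ)) - ((s'.1 κ : ℕ) : ℝ)| with hn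
  rw [boxGreen_hessian_eq]
  set T : (Fin 4 → Bool) → ℝ := fun σ =>
    if σ b then
      (torusGreen (toTorus M y - refl M Dset σ (toTorus M y') + Pi.single b 1 + Pi.single a 1) -
        torusGreen (toTorus M y - refl M Dset σ (toTorus M y') + Pi.single b 1 + Pi.single a 1 - Pi.single b 1) -
        torusGreen (toTorus M y - refl M Dset σ (toTorus M y') + Pi.single b 1) +
        torusGreen (toTorus M y - refl M Dset σ (toTorus M y') + Pi.single b 1 - Pi.single b 1))
    else
      -(torusGreen (toTorus M y - refl M Dset σ (toTorus M y') + Pi.single a 1) -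
        torusGreen (toTorus M y - refl M Dset σ (toTorus M y') + Pi.single a 1 - Pi.single b 1) -
        torusGreen (toTorus M y - refl M Dset σ (toTorus M y')) +
        torusGreen (toTorus M y - refl M Dset σ (toTorus M y') - Pi.single b 1)) with hT
  have hTσ : ∀ σ : Fin 4 → Bool, |T σ| * (1 + n) ^ 4 ≤ 81 * C₁ := by
    intro σ
    set u : TorusSite 4 (2 * M) := toTorus M y - refl M Dset σ (toTorus M y') with hu
    have huκ := sub_refl_apply_shift (M := M) (Dset := Dset) σ s s' a b t t' κ
    rw [← hy, ← hy', ← hu] at huκ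
    by_cases hσ : σ b = true
    · simp only [hT, hσ, if_true]
      have hBS : κ = b → σ κ = true := fun h => h ▸ hσ
      have hb := shift_bound_pos ht ht' (κ = a) (κ = b) (σ κ = true) hBS
      refine torusGreen_hessian_image_le hH s s' κ a b σ (u + Pi.single b 1)
        ((if κ = a then t else 0) + (if σ κ then (if κ = b then t' else 0) else -(if κ = b then t' else 0)) + (if κ = b then 1 else 0))
        hb.1 hb.2 ?_
      rw [Pi.add_apply, huκ, Pi.single_apply]
      push_cast
      split_ifs <;> ring
    · simp only [hT, hσ, Bool.false_eq_true, if_false, abs_neg]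
      have hBS : κ = b → ¬ σ κ = true := fun h => h ▸ hσ
      have hb := shift_bound_neg ht ht' (κ = a) (κ = b) (σ κ = true) hBS
      exact torusGreen_hessian_image_le hH s s' κ a b σ u
        ((if κ = a then t else 0) + (if σ κ then (if κ = b then t' else 0) else -(if κ = b then t' else 0))) hb.1 hb.2 huκ
  have h12 : (0 : ℝ) < 1 / 2 := by norm_num
  calc |(1 / 2 : ℝ) * ∑ σ : Fin 4 → Bool, sgn Dset σ * T σ| * (1 + n) ^ 4
        = (1 / 2 : ℝ) * (|∑ σ : Fin 4 → Bool, sgn Dset σ * T σ| * (1 + n) ^ 4) := by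
        rw [abs_mul, abs_of_pos h12, mul_assoc]
    _ ≤ (1 / 2 : ℝ) * ((∑ σ : Fin 4 → Bool, |sgn Dset σ * T σ|) * (1 + n) ^ 4) :=
        mul_le_mul_of_nonneg_left (mul_le_mul_of_nonneg_right (Finset.abs_sum_le_sum_abs _ _) (by positivity)) h12.le
    _ = (1 / 2 : ℝ) * ∑ σ : Fin 4 → Bool, |T σ| * (1 + n) ^ 4 := by
        rw [Finset.sum_mul]
        congr 1
        exact Finset.sum_congr rfl fun σ _ => by rw [abs_mul, abs_sgn, one_mul]
    _ ≤ (1 / 2 : ℝ) * ∑ σ : Fin 4 → Bool, (81 * C₁ : ℝ) :=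
        mul_le_mul_of_nonneg_left (Finset.sum_le_sum fun σ _ => hTσ σ) h12.le
    _ = 648 * C₁ := by
        rw [Finset.sum_const, Finset.card_univ, Fintype.card_fun, Fintype.card_bool, Fintype.card_fin, nsmul_eq_mul]
        push_cast
        ring

end Summit.QuantumFields.YangMills.Theorems.AllWindowsColdBox.BoxKernel

end
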